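import Mathlib
import Summits.Ventures.PercRepro.TriangleCapFifthBest

/-!
# PercRepro — THE BAND IS THE `Δ ≥ s − 2` LAYER, ITS LOCI, AND THE TOP FIVE VALUES OF THE `K₄⁻`-FREE CHERRY TABLE
(p3, gen 50; part 214)

* `band_iff_maxdeg` (`s ≥ 10`): a triangle-free graph with `s` edges has `Σ_v d(v)² ≥ s (s + 1) − 4 (s − 3) − 6` iff
  some vertex has degree `≥ s − 2` — above the band everything is a near-star, and the level-two stability
  `Σ d² + 6 (s − 4) ≤ s (s + 1)` keeps every graph with `Δ ≤ s − 3` strictly below it.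
* `band_locus` (`s ≥ 10`, `j ≤ 3`): a graph at the band value `s (s + 1) − 4 (s − 3) − 2 j` has a vertex `w` of
  degree `s − 2` whose two off-edges `e ≠ f` have `|N(w) ∩ e| + |N(w) ∩ f| + |e ∩ f| = 3 − j` (the near-star formula);
  `j = 1` is the fifth-best locus of the pair count (`fifth_locus_of_sum_deg_sq`).
* `cherry_top_five` (`3 ≤ a`, `6 ≤ r`, `2 a + r ≤ k`, `4 (r − 3) + 2 ≤ stabGapFull k a r`): on the cell, every
  `K₄⁻`-free graph within `4 (r − 3) + 2` of the closed form sits at one of the five values `closed`, `closed − 2 (r − 2)`,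
  `closed − 2 (r − 1)`, `closed − 4 (r − 3)`, `closed − 4 (r − 3) − 2`, and each of the five is attained.

Axioms: standard.
-/

namespace PercRepro

namespace TriangleCap

namespace C047

open Finset

variable {V : Type*} [Fintype V] [DecidableEq V]

/-- **THE BAND IS THE `Δ ≥ s − 2` LAYER:** for `s ≥ 10`, `s (s + 1) ≤ Σ_v d(v)² + 4 (s − 3) + 6` iff some vertex has
degree `≥ s − 2`. -/
theorem band_iff_maxdeg (H : SimpleGraph V) [DecidableRel H.Adj] (hfree : H.CliqueFree 3) (s : ℕ) (hs : 10 ≤ s)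
    (hm : H.edgeFinset.card = s) :
    s * (s + 1) ≤ ∑ v, deg H v * deg H v + 4 * (s - 3) + 6 ↔ ∃ w, s ≤ deg H w + 2 := by
  constructor
  · intro h
    by_contra hcon
    have hΔ : ∀ v, deg H v + 3 ≤ H.edgeFinset.card := fun v => by
      have : ¬ s ≤ deg H v + 2 := fun hv => hcon ⟨v, hv⟩
      omega
    have := sum_deg_sq_le_of_maxdeg3 H hfree (by omega) hΔ
    rw [hm] at this
    omega
  · rintro ⟨w, hw⟩
    have hwle : deg H w ≤ H.edgeFinset.card := by
      rw [deg_eq_degree, ← SimpleGraph.card_incidenceFinset_eq_degree]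
      exact card_le_card (H.incidenceFinset_subset w)
    rcases Nat.eq_or_lt_of_le hw with heq | hlt
    · obtain ⟨j, hj, hband⟩ := sum_deg_sq_two_off_band H hfree w (by omega) (by omega)
      rw [hm] at hband
      omega
    · rcases Nat.eq_or_lt_of_le (show s ≤ deg H w + 1 by omega) with heq1 | hlt1
      · obtain ⟨e, he, hwe⟩ := exists_edge_not_mem H w (by omega)
        have hall := mem_of_ne_of_deg_eq_pred H w (by omega) e he hwe
        by_cases hend : ∀ u ∈ e, ¬ H.Adj w u
        · have := sum_deg_sq_of_star_plus_pair H w (by omega) e he hwe hend hall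
          rw [hm] at this
          omega
        · obtain ⟨u, hu, hadj⟩ : ∃ u ∈ e, H.Adj w u := by
            by_contra h
            exact hend (fun u hu hadj => h ⟨u, hu, hadj⟩)
          obtain ⟨v, rfl⟩ := Sym2.mem_iff_exists.mp hu
          have huv : H.Adj u v := (SimpleGraph.mem_edgeSet H).mp (SimpleGraph.mem_edgeFinset.mp he)
          have hwv : w ≠ v := fun h => hwe (h ▸ Sym2.mem_mk_right u v)
          have hu2 : 2 ≤ deg H u := two_le_deg_of_adj_adj H u w v hwv hadj.symm huv
          have := sum_deg_sq_ge_of_adj H w u (by omega) hadj hu2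
          rw [hm] at this
          omega
      · have hwr : deg H w = H.edgeFinset.card := by omega
        have := sum_deg_sq_eq_of_deg_eq_card H w hwr
        rw [hm] at this
        omega

/-- **THE BAND LOCI:** for `s ≥ 10` and `j ≤ 3`, a triangle-free graph with `Σ_v d(v)² + 4 (s − 3) + 2 j = s (s + 1)`
has a vertex `w` of degree `s − 2` whose two off-edges `e ≠ f` have `|N(w) ∩ e| + |N(w) ∩ f| + |e ∩ f| = 3 − j`. -/
theorem band_locus (H : SimpleGraph V) [DecidableRel H.Adj] (hfree : H.CliqueFree 3) (s : ℕ) (hs : 10 ≤ s)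
    (hm : H.edgeFinset.card = s) (j : ℕ) (hj : j ≤ 3)
    (hS : ∑ v, deg H v * deg H v + 4 * (s - 3) + 2 * j = s * (s + 1)) :
    ∃ w, deg H w + 2 = s ∧ ∃ e f, e ∈ H.edgeFinset ∧ f ∈ H.edgeFinset ∧ e ≠ f ∧ w ∉ e ∧ w ∉ f ∧
      (∀ g ∈ H.edgeFinset, w ∈ g ∨ g = e ∨ g = f) ∧
      (univ.filter (fun v => H.Adj w v ∧ v ∈ e)).card + (univ.filter (fun v => H.Adj w v ∧ v ∈ f)).card +
        (univ.filter (fun v => v ∈ e ∧ v ∈ f)).card + j = 3 := by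
  obtain ⟨w, hw⟩ := (band_iff_maxdeg H hfree s hs hm).mp (by omega)
  have hwle : deg H w ≤ H.edgeFinset.card := by
    rw [deg_eq_degree, ← SimpleGraph.card_incidenceFinset_eq_degree]
    exact card_le_card (H.incidenceFinset_subset w)
  rcases Nat.eq_or_lt_of_le hw with heq | hlt
  · refine ⟨w, heq.symm, ?_⟩
    obtain ⟨e, f, he, hf, hef, hwe, hwf, hall⟩ := two_off_of_deg H w (by omega)
    have hform := sum_deg_sq_two_off H w e f he hf hwe hwf hef hall
    have c1 := card_adj_mem_le_one H hfree w e he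
    have c2 := card_adj_mem_le_one H hfree w f hf
    have c3 := card_mem_mem_le_one e f hef
    refine ⟨e, f, he, hf, hef, hwe, hwf, hall, ?_⟩
    obtain ⟨d, hd⟩ : ∃ d, deg H w = d := ⟨_, rfl⟩
    rw [hd] at heq hform
    rw [heq] at hS hs
    have e1 : (d + 2) * (d + 2 + 1) = d * d + 5 * d + 6 := by ring
    have e2 : d + 2 - 3 = d - 1 := by omega
    rw [e1, e2] at hS
    omega
  · exfalso
    rcases Nat.eq_or_lt_of_le (show s ≤ deg H w + 1 by omega) with heq1 | hlt1
    · obtain ⟨e, he, hwe⟩ := exists_edge_not_mem H w (by omega)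
      have hall := mem_of_ne_of_deg_eq_pred H w (by omega) e he hwe
      by_cases hend : ∀ u ∈ e, ¬ H.Adj w u
      · have := sum_deg_sq_of_star_plus_pair H w (by omega) e he hwe hend hall
        rw [hm] at this
        omega
      · obtain ⟨u, hu, hadj⟩ : ∃ u ∈ e, H.Adj w u := by
          by_contra h
          exact hend (fun u hu hadj => h ⟨u, hu, hadj⟩)
        obtain ⟨v, rfl⟩ := Sym2.mem_iff_exists.mp hu
        have huv : H.Adj u v := (SimpleGraph.mem_edgeSet H).mp (SimpleGraph.mem_edgeFinset.mp he)
        have hwv : w ≠ v := fun h => hwe (h ▸ Sym2.mem_mk_right u v)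
        have hu2 : 2 ≤ deg H u := two_le_deg_of_adj_adj H u w v hwv hadj.symm huv
        have := sum_deg_sq_ge_of_adj H w u (by omega) hadj hu2
        rw [hm] at this
        omega
    · have hwr : deg H w = H.edgeFinset.card := by omega
      have := sum_deg_sq_eq_of_deg_eq_card H w hwr
      rw [hm] at this
      omega

/-- **THE FIFTH-BEST LOCUS OF THE PAIR COUNT** (`s ≥ 10`): a triangle-free graph with
`Σ_v d(v)² + 4 (s − 3) + 2 = s (s + 1)` has a vertex `w` of degree `s − 2` whose two off-edges have
`|N(w) ∩ e| + |N(w) ∩ f| + |e ∩ f| = 2` — two pairs at two different leaves, or a path of length two hung at a leaf. -/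
theorem fifth_locus_of_sum_deg_sq (H : SimpleGraph V) [DecidableRel H.Adj] (hfree : H.CliqueFree 3) (s : ℕ)
    (hs : 10 ≤ s) (hm : H.edgeFinset.card = s)
    (hS : ∑ v, deg H v * deg H v + 4 * (s - 3) + 2 = s * (s + 1)) :
    ∃ w, deg H w + 2 = s ∧ ∃ e f, e ∈ H.edgeFinset ∧ f ∈ H.edgeFinset ∧ e ≠ f ∧ w ∉ e ∧ w ∉ f ∧
      (∀ g ∈ H.edgeFinset, w ∈ g ∨ g = e ∨ g = f) ∧
      (univ.filter (fun v => H.Adj w v ∧ v ∈ e)).card + (univ.filter (fun v => H.Adj w v ∧ v ∈ f)).card +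
        (univ.filter (fun v => v ∈ e ∧ v ∈ f)).card = 2 := by
  obtain ⟨w, hw, e, f, he, hf, hef, hwe, hwf, hall, hc⟩ :=
    band_locus H hfree s hs hm 1 (by omega) (by rw [mul_one]; exact hS)
  exact ⟨w, hw, e, f, he, hf, hef, hwe, hwf, hall, by omega⟩

/-- **THE TOP FIVE VALUES OF THE CHERRY TABLE:** on every cell `(k, a, r)` with `3 ≤ a`, `6 ≤ r`, `2 a + r ≤ k`
(`r + 7 ≤ k` on the row `a = 3`) and `4 (r − 3) + 2 ≤ stabGapFull k a r`, a `K₄⁻`-free graph with `a (k − a) − r` edges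
within `4 (r − 3) + 2` of the closed form sits at one of the five values `closed`, `closed − 2 (r − 2)`,
`closed − 2 (r − 1)`, `closed − 4 (r − 3)`, `closed − (4 (r − 3) + 2)`, and each of the five is attained. -/
theorem cherry_top_five (k a r : ℕ) (ha3 : 3 ≤ a) (hr6 : 6 ≤ r) (hk : 2 * a + r ≤ k) (hk3 : a = 3 → r + 7 ≤ k)
    (hgap : 4 * (r - 3) + 2 ≤ stabGapFull k a r) :
    (∀ (D : SimpleGraph (Fin k)) [DecidableRel D.Adj], K4mFree D → D.edgeFinset.card + r = a * (k - a) →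
        D.edgeFinset.card * k ≤ ∑ v, deg D v * deg D v + r * (k - 1 - r) + (4 * (r - 3) + 2) →
        ∑ v, deg D v * deg D v + r * (k - 1 - r) = D.edgeFinset.card * k ∨
        ∑ v, deg D v * deg D v + r * (k - 1 - r) + 2 * (r - 2) = D.edgeFinset.card * k ∨
        ∑ v, deg D v * deg D v + r * (k - 1 - r) + 2 * (r - 1) = D.edgeFinset.card * k ∨
        ∑ v, deg D v * deg D v + r * (k - 1 - r) + 4 * (r - 3) = D.edgeFinset.card * k ∨
        ∑ v, deg D v * deg D v + r * (k - 1 - r) + (4 * (r - 3) + 2) = D.edgeFinset.card * k) ∧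
      (∀ g ∈ ({0, 2 * (r - 2), 2 * (r - 1), 4 * (r - 3), 4 * (r - 3) + 2} : Finset ℕ),
        ∃ (D : SimpleGraph (Fin k)) (_ : DecidableRel D.Adj), K4mFree D ∧ D.edgeFinset.card + r = a * (k - a) ∧
          ∑ v, deg D v * deg D v + r * (k - 1 - r) + g = D.edgeFinset.card * k) := by
  have hcard : Fintype.card (Fin k) = k := Fintype.card_fin k
  refine ⟨?_, ?_⟩
  · intro D _ hK hm hle
    by_cases h1 : ∑ v, deg D v * deg D v + r * (k - 1 - r) = D.edgeFinset.card * k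
    · exact Or.inl h1
    by_cases h2 : ∑ v, deg D v * deg D v + r * (k - 1 - r) + 2 * (r - 2) = D.edgeFinset.card * k
    · exact Or.inr (Or.inl h2)
    by_cases h3 : ∑ v, deg D v * deg D v + r * (k - 1 - r) + 2 * (r - 1) = D.edgeFinset.card * k
    · exact Or.inr (Or.inr (Or.inl h3))
    by_cases h4 : ∑ v, deg D v * deg D v + r * (k - 1 - r) + 4 * (r - 3) = D.edgeFinset.card * k
    · exact Or.inr (Or.inr (Or.inr (Or.inl h4)))
    right; right; right; right
    have h4' : ∑ v, deg D v * deg D v + r * (k - 1 - r) + min (4 * (r - 3)) (stabGapFull k a r) ≠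
        D.edgeFinset.card * k := by
      rw [min_eq_left (by omega)]
      exact h4
    have := (cherry_fifth_best k a r ha3 hr6 hk hk3).1 D hK hm h1 h2 h3 h4'
    rw [min_eq_left hgap] at this
    omega
  · intro g hg
    simp only [mem_insert, mem_singleton] at hg
    rcases hg with rfl | rfl | rfl | rfl | rfl
    · have hK := k4mFree_bipMinusStar k a r
      have hE := card_edges_bipMinusStar k a r (by omega) (by omega)
      have hS := sum_deg_sq_bipMinusStar k a r (by omega) (by omega) (by omega)
      rw [hcard] at hS
      exact ⟨bipMinusStar k a r, inferInstance, hK, hE, by rw [add_zero]; exact hS⟩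
    · obtain ⟨D, inst, A, hK, -, -, -, hE, hS⟩ := broom_value k a r (by omega) (by omega) (by omega)
      have hE' : D.edgeFinset.card + r = a * (k - a) := by
        have : r ≤ a * (k - a) := by
          have h2 : 1 * (k - a) ≤ a * (k - a) := Nat.mul_le_mul_right _ (by omega)
          omega
        omega
      refine ⟨D, inst, hK, hE', ?_⟩
      rw [hE]
      exact hS
    · obtain ⟨hK, hE, hS⟩ := starPlusPair_value k a r (by omega) (by omega) (by omega)
      exact ⟨starPlusPair k a r (by omega), inferInstance, hK, hE, hS⟩
    · obtain ⟨hK, hE, hS⟩ := twoPairsAtLeaf_value k a r ha3 (by omega) (by omega) (by omega)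
      exact ⟨twoPairsAtLeaf k a r (by omega) (by omega) (by omega), inferInstance, hK, hE, hS⟩
    · obtain ⟨hK, hE, hS⟩ := twoPairsAtTwoLeaves_value k a r ha3 (by omega) (by omega) (by omega)
      exact ⟨twoPairsAtTwoLeaves k a r (by omega) (by omega) (by omega) (by omega), inferInstance, hK, hE, hS⟩

end C047

end TriangleCap

end PercRepro
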